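import Mathlib
import Summits.SmoothPoincare4.SmoothPoincare4.Theorems.ShadowsStandard.Negative.ShadowLevels

/-!
# Negative lemmas for the crux `ShadowsStandard` (item stmt-SmoothPoincare4-14593), V:
# the power subgroup `Mod_g[e]` and TWIST ABSORPTION (line `power-twist-absorption`)

Route `CongruenceShadows`, crux `ShadowsStandard`; line `Cruxes/ShadowsStandard/Lines/power-twist-absorption.lean`.
Refuter toolkit (drefute seats `…-14593-0`, `…-14593-g2-0`); pure group theory over `GroupTrisections.lean`,
no new facts. Companion file `PowerTwistGate.lean` (load-bearing analysis of the lead-held stub) imports it.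

The line factors the third kernel of a Waldhausen-normalised `(3+3m; m+1)` group trisection
`K = (N₀, N₁, K₂)` of the trivial group as `K₂ = y(t(c(N₂)))` with `y ∈ A ∩ B = Stab N₀ ∩ Stab N₁` (exact
Goeritz factor), `c ∈ C = Stab N₂` (exact handlebody factor) and `t` in the POWER SUBGROUP
`powerTwists m e ◁ Aut S` (normal closure of the `e`-th powers of the based Dehn-twist automorphisms; image
Funar's `Mod_g[e]` in `Out S`). This file carries the skeleton's notions VERBATIM (`Sg`, `CongruentMod`,
`congruenceKernel`, `IsStdTwist`, `boundaryWord`, `IsSepTwist`, `IsDehnTwist`, `powerTwists`) so that Negative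
lemmas, ideators and later skeleton versions can import them (the skeleton's closed statements are kept INLINE:
its `PowerTwistGate` is literally `∀ m e, 2 ≤ e → GateAt m e`, its `TwistAbsorption` is the type of
`twistAbsorption` below), and PROVES the line's lever:

* `twistAbsorption` (type = the skeleton's `TwistAbsorption`) — for `M` characteristic with `s ^ e ∈ M ∀ s`, every element of
  `powerTwists m e` is congruent to the identity modulo `M` (generatorwise: `T₀^e(b₁)b₁⁻¹ = b₁a₁^e b₁⁻¹`,
  `T₀^e(x)x⁻¹ = w_h^e (x w_h^{-e} x⁻¹)`; conjugation invariance consumes `Characteristic`);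
* `sup_eq_map_of_factorisation` — the SHADOW of a gate factorisation: modulo any such `M`,
  `K₂ · M = y(N₂ · M)`; the factors `t` and `c` are invisible, only the Goeritz factor survives
  (this is what every load-bearing witness of `PowerTwistGate.lean` exploits);
* `GateAt m e` (the gate at one parameter pair) with `powerTwistGate_iff_gateAt` (exponent analysis:
  `GateExponent.lean`; load-bearing analysis: `PowerTwistGate.lean`).
-/

noncomputable section

namespace Summit.SmoothPoincare4.SmoothPoincare4.Theorems.ShadowsStandard.Negative.PowerTwist

open Literature.Topology.FourManifolds Subgroup
/-! ## §1 Congruence modulo a level (skeleton §1, verbatim) -/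

/-- The surface group of the crux at parameter `m` (genus `3 + 3m`). [folklore] -/
abbrev Sg (m : ℕ) : Type := SurfaceGroup (3 + 3 * m)

/-- `φ ≡ id (mod M)`: `φ(s)·s⁻¹ ∈ M` for all `s`. [folklore] -/
def CongruentMod {m : ℕ} (M : Subgroup (Sg m)) (φ : Sg m ≃* Sg m) : Prop :=
  ∀ s : Sg m, φ s * s⁻¹ ∈ M

/-- [folklore] -/
theorem congruentMod_one {m : ℕ} (M : Subgroup (Sg m)) : CongruentMod M 1 := fun s => by simp [M.one_mem]

/-- [folklore] -/
theorem CongruentMod.mul {m : ℕ} {M : Subgroup (Sg m)} {φ ψ : Sg m ≃* Sg m}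
    (hφ : CongruentMod M φ) (hψ : CongruentMod M ψ) : CongruentMod M (φ * ψ) := by
  intro s
  have h : (φ * ψ) s * s⁻¹ = (φ (ψ s) * (ψ s)⁻¹) * (ψ s * s⁻¹) := by
    rw [MulAut.mul_apply]; group
  rw [h]
  exact M.mul_mem (hφ (ψ s)) (hψ s)

/-- [folklore] -/
theorem CongruentMod.inv {m : ℕ} {M : Subgroup (Sg m)} {φ : Sg m ≃* Sg m}
    (hφ : CongruentMod M φ) : CongruentMod M φ⁻¹ := by
  intro s
  have h1 : φ (φ⁻¹ s) * (φ⁻¹ s)⁻¹ ∈ M := hφ (φ⁻¹ s)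
  rw [MulAut.apply_inv_self] at h1
  have h2 := M.inv_mem h1
  simpa using h2

/-- Conjugation invariance — where `M.Characteristic` is consumed. [folklore] -/
theorem CongruentMod.conj {m : ℕ} {M : Subgroup (Sg m)} (hM : M.Characteristic)
    {φ : Sg m ≃* Sg m} (hφ : CongruentMod M φ) (α : Sg m ≃* Sg m) :
    CongruentMod M (α * φ * α⁻¹) := by
  intro s
  have h1 : φ (α⁻¹ s) * (α⁻¹ s)⁻¹ ∈ M := hφ _
  have h2 : φ (α⁻¹ s) * (α⁻¹ s)⁻¹ ∈ M.comap α.toMonoidHom := by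
    rw [hM.fixed α]; exact h1
  rw [Subgroup.mem_comap] at h2
  simpa [MulAut.mul_apply, map_mul, map_inv, MulAut.apply_inv_self] using h2

/-- The level-`M` congruence kernel as a subgroup of `Aut S`. [folklore] -/
def congruenceKernel {m : ℕ} (M : Subgroup (Sg m)) : Subgroup (Sg m ≃* Sg m) where
  carrier := {φ | CongruentMod M φ}
  mul_mem' := fun ha hb => CongruentMod.mul ha hb
  one_mem' := congruentMod_one M
  inv_mem' := fun ha => CongruentMod.inv ha

/-- For characteristic `M` the congruence kernel is normal in `Aut S`. [folklore] -/
theorem congruenceKernel_normal {m : ℕ} {M : Subgroup (Sg m)} (hM : M.Characteristic) :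
    (congruenceKernel M).Normal :=
  ⟨fun _ hφ α => CongruentMod.conj hM hφ α⟩

/-- Generator criterion: for NORMAL `M`, congruence on the `2g` standard generators suffices. [folklore] -/
theorem congruentMod_of_generators {m : ℕ} {M : Subgroup (Sg m)} [M.Normal] {φ : Sg m ≃* Sg m}
    (h : ∀ x : surfaceGen (3 + 3 * m),
      φ (PresentedGroup.of x) * (PresentedGroup.of x)⁻¹ ∈ M) :
    CongruentMod M φ := by
  let H : Subgroup (Sg m) :=
    { carrier := {s | φ s * s⁻¹ ∈ M}
      mul_mem' := by
        intro s t hs ht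
        have e : φ (s * t) * (s * t)⁻¹ = (φ s * s⁻¹) * (s * (φ t * t⁻¹) * s⁻¹) := by
          rw [map_mul]; group
        change φ (s * t) * (s * t)⁻¹ ∈ M
        rw [e]
        exact M.mul_mem hs (Subgroup.Normal.conj_mem inferInstance _ ht s)
      one_mem' := by
        change φ 1 * (1 : Sg m)⁻¹ ∈ M
        simp [M.one_mem]
      inv_mem' := by
        intro s hs
        change φ s⁻¹ * s⁻¹⁻¹ ∈ M
        have h1 : s * (φ s)⁻¹ ∈ M := by simpa using M.inv_mem hs
        have h2 : s⁻¹ * (s * (φ s)⁻¹) * s⁻¹⁻¹ ∈ M := Subgroup.Normal.conj_mem inferInstance _ h1 s⁻¹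
        simpa [map_inv, mul_assoc] using h2 }
  intro s
  exact PresentedGroup.generated_by _ H h s

/-- Twist absorption fixes shadows: an `M`-congruent automorphism fixes every `K ⊔ M`. [folklore] -/
theorem map_sup_eq_of_congruentMod {m : ℕ} (M : Subgroup (Sg m)) (φ : Sg m ≃* Sg m)
    (hφ : CongruentMod M φ) (K : Subgroup (Sg m)) :
    (K ⊔ M).map φ.toMonoidHom = K ⊔ M := by
  apply le_antisymm
  · rintro _ ⟨x, hx, rfl⟩
    have h1 : φ x * x⁻¹ ∈ K ⊔ M := Subgroup.mem_sup_right (hφ x)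
    have h2 : (φ x * x⁻¹) * x ∈ K ⊔ M := Subgroup.mul_mem _ h1 hx
    simpa using h2
  · intro x hx
    refine ⟨φ.symm x, ?_, by simp⟩
    have h1 : φ (φ.symm x) * (φ.symm x)⁻¹ ∈ M := hφ (φ.symm x)
    rw [MulEquiv.apply_symm_apply] at h1
    have h2 : (x * (φ.symm x)⁻¹)⁻¹ * x ∈ K ⊔ M :=
      Subgroup.mul_mem _ (Subgroup.inv_mem _ (Subgroup.mem_sup_right h1)) hx
    have h3 : (x * (φ.symm x)⁻¹)⁻¹ * x = φ.symm x := by group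
    simpa [h3] using h2

/-- A congruent automorphism maps `M` onto itself. [folklore] -/
theorem map_eq_of_congruentMod {m : ℕ} (M : Subgroup (Sg m)) (φ : Sg m ≃* Sg m)
    (hφ : CongruentMod M φ) : M.map φ.toMonoidHom = M := by
  simpa using map_sup_eq_of_congruentMod M φ hφ M

/-! ## §2 Based Dehn twists and the power subgroup `Mod_g[e]` (skeleton §2–§3, verbatim) -/

/-- The index of the first handle. [folklore] -/
def h0 (m : ℕ) : Fin (3 + 3 * m) := ⟨0, by omega⟩

/-- The standard transvection `b₁ ↦ b₁a₁`. [folklore] -/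
def IsStdTwist {m : ℕ} (T : Sg m ≃* Sg m) : Prop :=
  ∀ x : surfaceGen (3 + 3 * m),
    T (PresentedGroup.of x) =
      if x = (h0 m, true) then PresentedGroup.of (h0 m, true) * PresentedGroup.of (h0 m, false)
      else PresentedGroup.of x

/-- The boundary word `w_h = ∏_{i<h} [aᵢ, bᵢ]` of the first `h` handles. [folklore] -/
def boundaryWord (m h : ℕ) : Sg m :=
  PresentedGroup.mk _ ((((List.finRange (3 + 3 * m)).filter fun i => i.val < h).map
    fun i => genA i * genB i * (genA i)⁻¹ * (genB i)⁻¹).prod)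

/-- The partial conjugation by `w_h` on the first `h` handles (separating twist). [folklore] -/
def IsSepTwist {m : ℕ} (h : ℕ) (T : Sg m ≃* Sg m) : Prop :=
  ∀ x : surfaceGen (3 + 3 * m),
    T (PresentedGroup.of x) =
      if x.1.val < h then boundaryWord m h * PresentedGroup.of x * (boundaryWord m h)⁻¹
      else PresentedGroup.of x

/-- Based Dehn-twist automorphisms: `Aut S`-conjugates of the standard ones. [folklore] -/
def IsDehnTwist {m : ℕ} (T : Sg m ≃* Sg m) : Prop :=
  ∃ φ T₀ : Sg m ≃* Sg m, (IsStdTwist T₀ ∨ ∃ h : ℕ, IsSepTwist h T₀) ∧ T = φ * T₀ * φ⁻¹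

/-- The power subgroup `powerTwists m e ◁ Aut S_{3+3m}` (image `Mod_g[e]` in `Out S`). [folklore] -/
def powerTwists (m e : ℕ) : Subgroup (Sg m ≃* Sg m) :=
  Subgroup.normalClosure {t | ∃ T : Sg m ≃* Sg m, IsDehnTwist T ∧ t = T ^ e}

/-- [folklore] -/
instance powerTwists_normal (m e : ℕ) : (powerTwists m e).Normal := Subgroup.normalClosure_normal

/-- The mod-`e` gate AT a fixed parameter pair `(m, e)`: for every Waldhausen-normalised `(3+3m; m+1)` group
trisection `K = (N₀, N₁, K₂)` of the trivial group, `K₂ = y(t(c(N₂)))` with `y ∈ Stab N₀ ∩ Stab N₁` exact,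
`t ∈ powerTwists m e`, `c ∈ Stab N₂` exact. The skeleton's lead-held stub `stub_powerTwistGate = PowerTwistGate` is
LITERALLY `∀ m e, 2 ≤ e → GateAt m e`. [folklore] -/
def GateAt (m e : ℕ) : Prop :=
  ∀ K : TrisectionKernels (3 + 3 * m),
    IsGroupTrisection (3 + 3 * m) (m + 1) (PUnit : Type) K → K 0 = N m 0 → K 1 = N m 1 →
    ∃ y t c : Sg m ≃* Sg m,
      (N m 0).map y.toMonoidHom = N m 0 ∧ (N m 1).map y.toMonoidHom = N m 1 ∧
      t ∈ powerTwists m e ∧ (N m 2).map c.toMonoidHom = N m 2 ∧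
      K 2 = (((N m 2).map c.toMonoidHom).map t.toMonoidHom).map y.toMonoidHom

/-! ## §3 Twist absorption (the lever) PROVED, and the shadow of a gate factorisation -/

/-- Powers of a standard transvection fix every generator other than `b₁`. [folklore] -/
theorem pow_apply_of_isStdTwist_ne {m : ℕ} {T : Sg m ≃* Sg m} (hT : IsStdTwist T) (e : ℕ)
    {x : surfaceGen (3 + 3 * m)} (hx : x ≠ (h0 m, true)) :
    (T ^ e) (PresentedGroup.of x) = PresentedGroup.of x := by
  induction e with
  | zero => simp
  | succ n ih =>
    rw [pow_succ, MulAut.mul_apply, hT x, if_neg hx, ih]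

/-- `T^e(b₁) = b₁ a₁^e` for the standard transvection. [folklore] -/
theorem pow_apply_of_isStdTwist_self {m : ℕ} {T : Sg m ≃* Sg m} (hT : IsStdTwist T) (e : ℕ) :
    (T ^ e) (PresentedGroup.of (h0 m, true)) =
      PresentedGroup.of (h0 m, true) * PresentedGroup.of (h0 m, false) ^ e := by
  induction e with
  | zero => simp
  | succ n ih =>
    have hne : ((h0 m, false) : surfaceGen (3 + 3 * m)) ≠ (h0 m, true) := by simp
    rw [pow_succ, MulAut.mul_apply, hT (h0 m, true), if_pos rfl, map_mul, ih,
      pow_apply_of_isStdTwist_ne hT n hne, pow_succ, mul_assoc]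

/-- `T₀ ^ e ≡ id (mod M)` for the standard transvection when `M ◁ S` contains all `e`-th powers. [folklore] -/
theorem congruentMod_pow_of_isStdTwist {m : ℕ} {M : Subgroup (Sg m)} [M.Normal]
    {T : Sg m ≃* Sg m} (hT : IsStdTwist T) {e : ℕ} (he : ∀ s : Sg m, s ^ e ∈ M) :
    CongruentMod M (T ^ e) := by
  refine congruentMod_of_generators ?_
  intro x
  by_cases hx : x = (h0 m, true)
  · subst hx
    rw [pow_apply_of_isStdTwist_self hT e]
    exact Subgroup.Normal.conj_mem inferInstance _ (he _) _
  · rw [pow_apply_of_isStdTwist_ne hT e hx, mul_inv_cancel]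
    exact M.one_mem

/-- A separating partial conjugation fixes its own boundary word. [folklore] -/
theorem apply_boundaryWord_of_isSepTwist {m : ℕ} {h : ℕ} {T : Sg m ≃* Sg m}
    (hT : IsSepTwist h T) : T (boundaryWord m h) = boundaryWord m h := by
  set w : Sg m := boundaryWord m h with hw
  let H : Subgroup (Sg m) :=
    { carrier := {s | T s = w * s * w⁻¹}
      mul_mem' := by
        intro s t hs ht
        change T (s * t) = w * (s * t) * w⁻¹
        change T s = w * s * w⁻¹ at hs
        change T t = w * t * w⁻¹ at ht
        rw [map_mul, hs, ht]; group
      one_mem' := by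
        change T 1 = w * 1 * w⁻¹
        simp
      inv_mem' := by
        intro s hs
        change T s⁻¹ = w * s⁻¹ * w⁻¹
        change T s = w * s * w⁻¹ at hs
        rw [map_inv, hs]; group }
  have hgen : ∀ x : surfaceGen (3 + 3 * m), x.1.val < h → (PresentedGroup.of x : Sg m) ∈ H := by
    intro x hx
    change T (PresentedGroup.of x) = w * PresentedGroup.of x * w⁻¹
    rw [hT x, if_pos hx]
  have hwH : w ∈ H := by
    rw [hw, boundaryWord, map_list_prod]
    refine Subgroup.list_prod_mem _ ?_
    intro y hy
    rw [List.map_map, List.mem_map] at hy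
    obtain ⟨i, hi, rfl⟩ := hy
    rw [List.mem_filter] at hi
    have hi' : i.val < h := by simpa using hi.2
    have ha : (PresentedGroup.of (i, false) : Sg m) ∈ H := hgen (i, false) hi'
    have hb : (PresentedGroup.of (i, true) : Sg m) ∈ H := hgen (i, true) hi'
    change PresentedGroup.mk _ (genA i * genB i * (genA i)⁻¹ * (genB i)⁻¹) ∈ H
    rw [map_mul, map_mul, map_mul, map_inv, map_inv]
    exact H.mul_mem (H.mul_mem (H.mul_mem ha hb) (H.inv_mem ha)) (H.inv_mem hb)
  have key : T w = w * w * w⁻¹ := hwH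
  rw [key, mul_inv_cancel_right]

/-- [folklore] -/
theorem pow_apply_boundaryWord_of_isSepTwist {m : ℕ} {h : ℕ} {T : Sg m ≃* Sg m}
    (hT : IsSepTwist h T) (n : ℕ) : (T ^ n) (boundaryWord m h) = boundaryWord m h := by
  induction n with
  | zero => simp
  | succ n ih => rw [pow_succ, MulAut.mul_apply, apply_boundaryWord_of_isSepTwist hT, ih]

/-- [folklore] -/
theorem pow_apply_of_isSepTwist_lt {m : ℕ} {h : ℕ} {T : Sg m ≃* Sg m} (hT : IsSepTwist h T)
    (n : ℕ) {x : surfaceGen (3 + 3 * m)} (hx : x.1.val < h) :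
    (T ^ n) (PresentedGroup.of x) =
      boundaryWord m h ^ n * PresentedGroup.of x * (boundaryWord m h ^ n)⁻¹ := by
  induction n with
  | zero => simp
  | succ n ih =>
    rw [pow_succ, MulAut.mul_apply, hT x, if_pos hx, map_mul, map_mul, map_inv,
      pow_apply_boundaryWord_of_isSepTwist hT n, ih, pow_succ', mul_inv_rev]
    group

/-- [folklore] -/
theorem pow_apply_of_isSepTwist_not_lt {m : ℕ} {h : ℕ} {T : Sg m ≃* Sg m}
    (hT : IsSepTwist h T) (n : ℕ) {x : surfaceGen (3 + 3 * m)} (hx : ¬ x.1.val < h) :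
    (T ^ n) (PresentedGroup.of x) = PresentedGroup.of x := by
  induction n with
  | zero => simp
  | succ n ih => rw [pow_succ, MulAut.mul_apply, hT x, if_neg hx, ih]

/-- `T₀ ^ e ≡ id (mod M)` for a separating partial conjugation. [folklore] -/
theorem congruentMod_pow_of_isSepTwist {m : ℕ} {M : Subgroup (Sg m)} [M.Normal] {h : ℕ}
    {T : Sg m ≃* Sg m} (hT : IsSepTwist h T) {e : ℕ} (he : ∀ s : Sg m, s ^ e ∈ M) :
    CongruentMod M (T ^ e) := by
  refine congruentMod_of_generators ?_
  intro x
  by_cases hx : x.1.val < h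
  · rw [pow_apply_of_isSepTwist_lt hT e hx]
    have h1 : boundaryWord m h ^ e ∈ M := he _
    have h2 : PresentedGroup.of x * (boundaryWord m h ^ e)⁻¹ * (PresentedGroup.of x)⁻¹ ∈ M :=
      Subgroup.Normal.conj_mem inferInstance _ (M.inv_mem h1) _
    have h3 := M.mul_mem h1 h2
    simpa [mul_assoc] using h3
  · rw [pow_apply_of_isSepTwist_not_lt hT e hx, mul_inv_cancel]
    exact M.one_mem

/-- **The lever holds**: power-twist absorption — for `M` characteristic with `s ^ e ∈ M` for all `s`, every
element of `powerTwists m e` is congruent to the identity modulo `M` (the type is the skeleton's `TwistAbsorption`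
verbatim, so `twistAbsorption` closes `stub_twistAbsorption` / the pieces 2a–2c in aggregate). [folklore] -/
theorem twistAbsorption :
    ∀ (m e : ℕ) (M : Subgroup (Sg m)), M.Characteristic → (∀ s : Sg m, s ^ e ∈ M) →
      ∀ t : Sg m ≃* Sg m, t ∈ powerTwists m e → CongruentMod M t := by
  intro m e M hM he t ht
  haveI : M.Characteristic := hM
  haveI : (congruenceKernel M).Normal := congruenceKernel_normal hM
  have hsub : {t | ∃ T : Sg m ≃* Sg m, IsDehnTwist T ∧ t = T ^ e} ⊆
      ((congruenceKernel M : Subgroup (Sg m ≃* Sg m)) : Set (Sg m ≃* Sg m)) := by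
    rintro _ ⟨T, ⟨φ, T₀, hT₀, rfl⟩, rfl⟩
    change CongruentMod M ((φ * T₀ * φ⁻¹) ^ e)
    rw [conj_pow]
    refine CongruentMod.conj hM ?_ φ
    rcases hT₀ with hT₀ | ⟨h, hT₀⟩
    · exact congruentMod_pow_of_isStdTwist hT₀ he
    · exact congruentMod_pow_of_isSepTwist hT₀ he
  have hle : powerTwists m e ≤ congruenceKernel M := Subgroup.normalClosure_le_normal hsub
  exact hle ht

/-- **Shadow of a gate factorisation.** If `K₂ = y(t(c(N₂)))` with `t ∈ powerTwists m e`, `c ∈ Stab N₂`,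
then modulo ANY characteristic `M` containing all `e`-th powers, `K₂ · M = y(N₂ · M)`: the factors `t`
and `c` are invisible; only the Goeritz factor `y` survives. [folklore] -/
theorem sup_eq_map_of_factorisation {m e : ℕ} {M : Subgroup (Sg m)} (hM : M.Characteristic)
    (he : ∀ s : Sg m, s ^ e ∈ M) {K₂ : Subgroup (Sg m)} {y t c : Sg m ≃* Sg m}
    (ht : t ∈ powerTwists m e) (hc : (N m 2).map c.toMonoidHom = N m 2)
    (hK : K₂ = (((N m 2).map c.toMonoidHom).map t.toMonoidHom).map y.toMonoidHom) :
    K₂ ⊔ M = (N m 2 ⊔ M).map y.toMonoidHom := by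
  have htc : CongruentMod M t := twistAbsorption m e M hM he t ht
  have hyM : M.map y.toMonoidHom = M := (characteristic_iff_map_eq.1 hM) y
  have h1 : (N m 2 ⊔ M).map t.toMonoidHom = (N m 2).map t.toMonoidHom ⊔ M := by
    rw [Subgroup.map_sup, map_eq_of_congruentMod M t htc]
  have h3 : (N m 2).map t.toMonoidHom ⊔ M = N m 2 ⊔ M :=
    h1.symm.trans (map_sup_eq_of_congruentMod M t htc _)
  calc K₂ ⊔ M = ((N m 2).map t.toMonoidHom).map y.toMonoidHom ⊔ M.map y.toMonoidHom := by
        rw [hK, hc, hyM]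
    _ = ((N m 2).map t.toMonoidHom ⊔ M).map y.toMonoidHom := (Subgroup.map_sup _ _ _).symm
    _ = (N m 2 ⊔ M).map y.toMonoidHom := by rw [h3]

end Summit.SmoothPoincare4.SmoothPoincare4.Theorems.ShadowsStandard.Negative.PowerTwist

end
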